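import Literature.Barriers.CriticalPhenomena.LaceExpansionXSpaceNormsFejer
import Literature.Barriers.CriticalPhenomena.LaceExpansionHaraLemma41Cube
import HarnessLib

/-!
# Hara 2008, Lemma 1.7: reduction of the five clauses to `L^p` bounds on Fourier representatives
# of the coordinate-weighted two-point functions `G_j^{(β)}` — the `x`-space layer, proved

Barrier catalogue `Literature/Barriers/CriticalPhenomena/` (D-0021), support file for the
discharge of the named fact `Hara2008_lemma17Pc` (`LaceExpansionXSpaceNorms.lean`: Hara 2008,
Lemma 1.7 — the finiteness of `Ḡ^{(α)}, W̄^{(β,γ)}, T̄^{(β,γ)}, S̄^{(γ)}, H̄^{(β)}` at `p_c` from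
`Σ_x |x|^φ |Π(x)| < ∞`). Hara's proof (§4.1.1) first replaces the Euclidean weights `|x|^α` by
coordinate weights `|x_j|^α` ((4.1)–(4.3)), writes the diagrams "in Fourier space" ((4.4)–(4.8)) and
reduces everything to "a good control over `Ĝ_j^{(α)}(k)`, … so that we can prove integrability of
`Ĝ_j^{(α)}, Ĝ_j^{(β)} Ĝ_l^{(γ)}, …`" — for even integer exponents by Lemma 4.1 and power counting
(§4.1.2), for the others by fractional derivatives (§4.1.3–§4.1.4, §4.3–§4.4). This file PROVES
that reduction once and for all, in a form that any control of the transforms can be plugged into,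
together with the even-integer case and an `x`-space treatment of `H̄`:

* `HaraNorms.LpDominated f p` — `f` is dominated, box by box, by functions `h ≥ 0` with Fourier
  representatives `F` (`IsFourierPair h F` of `LaceExpansionXSpaceNormsFejer.lean`) obeying a uniform
  bound `∫_{[-π,π]^d} ‖F‖^p ≤ B < ∞`; API `of_global`, `mono`, `const_mul`, `exists_le` (`p = 1`:
  the bound "`G_j^{(α)}(a) ≤ ∫ |Ĝ_j^{(α)}|`", (4.9)), `of_isFourierPair`;
* `HaraNorms.exists_tsum_prod_le` and its parametrised forms `exists_tsum_pair_le`,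
  `exists_tsum_triple_le`, `exists_tsum_quad_le` — chains `Σ_{Σ y_i = a} Π u_i(y_i)` of
  `L^{1/w_i}`-dominated `u_i ≥ 0` (`Σ w_i = 1`) are bounded uniformly in `a` (the diagram bound
  `HaraNorms.ofReal_sum_prod_le`, applied on boxes);
* `coordG d β j = G_j^{(β)} = |x_j|^β τ_{p_c}(0,x)`, Hara's (4.3) `|x|^β ≤ (√d)^β Σ_j |x_j|^β`
  (`euclidNorm_rpow_le_sum`, `haraG_le_sum_coordG`), monotonicity in `β` on `ℤ^d` (`coordG_mono`);
* **the clauses from coordinate information**: `haraGBar_lt_top_of_coordG_le` /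
  `haraGBar_lt_top_of_lpDominated` (`Ḡ`), `haraWBar_lt_top_of_lpDominated` (`W̄`: `G_j^{(β)}` in
  `L^{1/w₀}`, `G_l^{(γ)}` in `L^{1/w₁}`, `w₀ + w₁ = 1`), `haraTBar_lt_top_of_lpDominated`,
  `haraSBar_lt_top_of_lpDominated`, and the Hölder weights realising the power counting
  (`HaraNorms.exists_weights₂/₃/₄`: `A + B < D` gives `w` with `A/w₀ = B/w₁ = A + B`);
* **`H̄^{(β)} ≤ W̄^{(β,0)} W̄^{(0,0)} S̄^{(0)}`** (`haraHBar_le_mul`, `haraHBar_lt_top_of_bars`) — an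
  `x`-space substitute (Tonelli on nonnegative sums: the bubble `Σ_y G(y-x)G(y+b-v) ≤ W̄^{(0,0)}`,
  then `Σ_x G^{(β)}(x)G(x-u) ≤ W̄^{(β,0)}`, the rest is the square `S^{(0)}(a)`) for Hara's
  `3d`-dimensional integral (4.8)/(4.15) and its "elementary power counting"; it yields the
  `H̄`-clause from the `W̄`- and `S̄`-clauses whenever `d > 8` (the fact has `d ≥ 11`);
* **the integer engine** `IsLaceCoefficientPc.lpDominated_coordG_even` (`_of_rpow`): `G_j^{(2b)}`
  has the representative `(-1)^b ∂_j^{2b} Ĝ` ((4.8), `LaceExpansionHaraLemma41Cube.lean`) with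
  `∫ |∂_j^{2b}Ĝ|^p ≤ C^p ∫ |k|^{-(2+2b)p} < ∞` for `(2+2b)p < d` (Lemma 4.1,
  `LaceExpansionHaraLemma41.lean`); `lpDominated_tau` (`b = 0`);
* **Lemma 1.7 for even integer exponents**: `IsLaceCoefficientPc.haraWBar_lt_top_even`
  (`2b, 2b' ≤ ⌊φ⌋`, `4 + 2b + 2b' < d`), `haraTBar_lt_top_even` (`6 + 2b + 2b' < d`),
  `haraSBar_lt_top_even` (`8 + 2b < d`), `haraHBar_lt_top_even` (`4 + 2b < d`, `d > 8`); the
  `Ḡ`-clause for these exponents is `IsLaceCoefficientPc.haraGBar_lt_top_of_rpow`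
  (`LaceExpansionHaraLemma17G.lean`).

What the discharge of `Hara2008_lemma17Pc` still needs after this file (the fractional engine):
`LpDominated (coordG d β j) p` for non-integer `0 < β < ⌊φ⌋₊` (hence `⌈β⌉ ≤ ⌊φ⌋`) and `p ≥ 1` with
`(2 + β)p < d` (Hara's Lemma 4.2 / §4.1.3; by `coordG_mono` only the exponents near the
power-counting thresholds are really needed), and the bound `sup_x |x_j|^α G(x) < ∞` for
`⌊φ⌋ < α ≤ φ`, `α < d - 2` (§4.1.4); then `haraWBar_lt_top_of_lpDominated` & co. and
`haraHBar_lt_top_of_bars` assemble the five clauses.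

## References

* T. Hara, Ann. Probab. 36 (2008) 530–593 (arXiv:math-ph/0504021): Lemma 1.7 (§1.2.4,
  (1.30)–(1.34)); §4.1.1 ((4.1)–(4.8): coordinate weights, the elementary inequality (4.3), the
  Fourier representations), §4.1.2 ((4.9), (4.13)–(4.15): "finite if `4 + β + γ < d`", "finite if
  `2 + γ + 6 < d`", "`H` requires more care"), §4.1.3 (non-integer exponents), Lemma 4.1.
-/

noncomputable section

namespace Literature.Barriers.CriticalPhenomena

open _root_.MeasureTheory _root_.Filter Finset Literature.Probability.LatticeModels
  Literature.Probability.Percolation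

open scoped ENNReal NNReal BigOperators

variable {d : ℕ}

namespace HaraNorms

/-! ### `L^p`-dominated lattice functions -/

/-- **`f` is (locally) dominated by functions with uniformly `L^p`-bounded Fourier
representatives**: there is `B < ∞` such that on every box `Λ_R` one has `f ≤ h` for some `h ≥ 0`
on `ℤ^d` represented as `h(x) = (2π)^{-d} ∫ e^{ik·x} F(k) dk` with `∫_{[-π,π]^d} ‖F‖^p ≤ B`. For
`f = G_j^{(β)} = |x_j|^β τ_{p_c}(0,x)` this is the form in which "a good control over
`Ĝ_j^{(β)}(k)` … so that we can prove integrability of `Ĝ_j^{(β)} Ĝ_l^{(γ)}, …`" enters the proof of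
Lemma 1.7 (a single global pair `(h, F)` is the basic example, `LpDominated.of_global`; the local
form lets fractional weights `|x_j|^β` be dominated box by box by finite trigonometric sums).
[cite: Hara2008, §4.1.1 ((4.4)–(4.8))] -/
structure LpDominated (f : Site d → ℝ) (p : ℝ) : Prop where
  /-- a uniform `L^p` bound for dominating representatives on boxes -/
  exists_bound : ∃ B : ℝ≥0∞, B < ⊤ ∧ ∀ R : ℕ, ∃ (h : Site d → ℝ) (F : (Fin d → ℝ) → ℂ),
    (∀ x, 0 ≤ h x) ∧ (∀ x ∈ box d R, f x ≤ h x) ∧ IsFourierPair h F ∧ (∫⁻ k in cube d, ‖F k‖ₑ ^ p) ≤ B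

/-- A single dominating function `h ≥ 0`, `h ≥ f`, with an `L^p` representative. [folklore] -/
theorem LpDominated.of_global {f h : Site d → ℝ} {F : (Fin d → ℝ) → ℂ} {p : ℝ} (hh : ∀ x, 0 ≤ h x)
    (hfh : ∀ x, f x ≤ h x) (hF : IsFourierPair h F) (hp : (∫⁻ k in cube d, ‖F k‖ₑ ^ p) < ⊤) :
    LpDominated f p :=
  ⟨⟨∫⁻ k in cube d, ‖F k‖ₑ ^ p, hp, fun _ => ⟨h, F, hh, fun x _ => hfh x, hF, le_rfl⟩⟩⟩

/-- Monotonicity in the dominated function. [folklore] -/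
theorem LpDominated.mono {f g : Site d → ℝ} {p : ℝ} (h : LpDominated g p) (hfg : ∀ x, f x ≤ g x) :
    LpDominated f p := by
  obtain ⟨B, hB, hR⟩ := h.exists_bound
  refine ⟨⟨B, hB, fun R => ?_⟩⟩
  obtain ⟨h, F, hh, hgh, hF, hp⟩ := hR R
  exact ⟨h, F, hh, fun x hx => (hfg x).trans (hgh x hx), hF, hp⟩

/-- Scaling by a nonnegative constant. [folklore] -/
theorem LpDominated.const_mul {f : Site d → ℝ} {p : ℝ} (h : LpDominated f p) (hp : 0 ≤ p) {c : ℝ}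
    (hc : 0 ≤ c) : LpDominated (fun x => c * f x) p := by
  obtain ⟨B, hB, hR⟩ := h.exists_bound
  refine ⟨⟨‖(c : ℂ)‖ₑ ^ p * B, ENNReal.mul_lt_top (ENNReal.rpow_lt_top_of_nonneg hp enorm_ne_top) hB, fun R => ?_⟩⟩
  obtain ⟨h, F, hh, hfh, hF, hFp⟩ := hR R
  refine ⟨fun x => c * h x, fun k => (c : ℂ) * F k, fun x => mul_nonneg hc (hh x),
    fun x hx => mul_le_mul_of_nonneg_left (hfh x hx) hc, ⟨hF.integrableOn.const_mul _, fun x => ?_⟩, ?_⟩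
  · push_cast
    rw [hF.repr x, ← mul_div_assoc, ← integral_const_mul]
    congr 1
    refine setIntegral_congr_fun (measurableSet_cube d) fun k _ => ?_
    ring
  · have hmeas : ∀ k, ‖(c : ℂ) * F k‖ₑ ^ p = ‖(c : ℂ)‖ₑ ^ p * ‖F k‖ₑ ^ p := fun k => by
      rw [enorm_mul, ENNReal.mul_rpow_of_nonneg _ _ hp]
    simp_rw [hmeas]
    rw [lintegral_const_mul' _ _ (ENNReal.rpow_ne_top_of_nonneg hp enorm_ne_top)]
    gcongr

/-- The value of a represented function is at most `(2π)^{-d} ∫ ‖F‖`. [cite: Hara2008, §4.1.2 ((4.9))] -/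
theorem _root_.Literature.Barriers.CriticalPhenomena.IsFourierPair.le_integral_norm {h : Site d → ℝ}
    {F : (Fin d → ℝ) → ℂ} (hF : IsFourierPair h F) (x : Site d) :
    h x ≤ (∫ k in cube d, ‖F k‖) / (2 * Real.pi) ^ d := by
  have hpos : (0 : ℝ) < (2 * Real.pi) ^ d := by positivity
  calc h x ≤ |h x| := le_abs_self _
    _ = ‖((h x : ℝ) : ℂ)‖ := by rw [Complex.norm_real, Real.norm_eq_abs]
    _ = ‖∫ k in cube d, Complex.exp (Complex.I * (kdot k x : ℂ)) * F k‖ / (2 * Real.pi) ^ d := by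
        rw [hF.repr x, norm_div]
        congr 1
        rw [show ((2 * Real.pi : ℂ) ^ d) = (((2 * Real.pi) ^ d : ℝ) : ℂ) by push_cast; ring,
          Complex.norm_real, Real.norm_of_nonneg hpos.le]
    _ ≤ (∫ k in cube d, ‖Complex.exp (Complex.I * (kdot k x : ℂ)) * F k‖) / (2 * Real.pi) ^ d := by
        gcongr
        exact norm_integral_le_integral_norm _
    _ = (∫ k in cube d, ‖F k‖) / (2 * Real.pi) ^ d := by
        congr 1
        refine setIntegral_congr_fun (measurableSet_cube d) fun k _ => ?_
        rw [norm_mul, norm_cexp_I_mul_kdot, one_mul]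

/-- An `L¹`-dominated function is bounded: `f(x) ≤ h_R(x) ≤ (2π)^{-d} ∫ ‖F_R‖ ≤ (2π)^{-d} B`. For
`f = G_j^{(α)}` this is "`G_j^{(α)}(a) ≤ ∫ |Ĝ_j^{(α)}(k)| d^dk/(2π)^d`".
[cite: Hara2008, §4.1.2 ((4.9))] -/
theorem LpDominated.exists_le {f : Site d → ℝ} (h : LpDominated f 1) : ∃ C : ℝ, ∀ x, f x ≤ C := by
  obtain ⟨B, hB, hR⟩ := h.exists_bound
  refine ⟨B.toReal / (2 * Real.pi) ^ d, fun x => ?_⟩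
  -- `x` lies in some box
  obtain ⟨R, hxR⟩ : ∃ R : ℕ, x ∈ box d R := by
    have hne : ∀ i : Fin d, ∃ m : ℕ, -(m : ℤ) ≤ x i ∧ x i ≤ m := fun i =>
      ⟨(x i).natAbs, by omega, by omega⟩
    choose m hm using hne
    refine ⟨Finset.univ.sup m, mem_box.2 fun i => ?_⟩
    have hi : m i ≤ Finset.univ.sup m := Finset.le_sup (Finset.mem_univ i)
    constructor
    · calc -((Finset.univ.sup m : ℕ) : ℤ) ≤ -(m i : ℤ) := by omega
        _ ≤ x i := (hm i).1
    · calc x i ≤ m i := (hm i).2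
        _ ≤ _ := by exact_mod_cast hi
  obtain ⟨h, F, -, hfh, hF, hF1⟩ := hR R
  have hpos : (0 : ℝ) < (2 * Real.pi) ^ d := by positivity
  have hfin : ∫⁻ k in cube d, ‖F k‖ₑ < ⊤ := by
    refine lt_of_le_of_lt (le_of_eq ?_) (lt_of_le_of_lt hF1 hB)
    exact lintegral_congr fun k => (ENNReal.rpow_one _).symm
  calc f x ≤ h x := hfh x hxR
    _ ≤ (∫ k in cube d, ‖F k‖) / (2 * Real.pi) ^ d := hF.le_integral_norm x
    _ ≤ B.toReal / (2 * Real.pi) ^ d := by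
        gcongr
        rw [integral_norm_eq_lintegral_enorm hF.integrableOn.aestronglyMeasurable]
        refine ENNReal.toReal_mono hB.ne ?_
        calc ∫⁻ k in cube d, ‖F k‖ₑ = ∫⁻ k in cube d, ‖F k‖ₑ ^ (1 : ℝ) :=
              lintegral_congr fun k => (ENNReal.rpow_one _).symm
          _ ≤ B := hF1

/-- A nonnegative function with a Fourier representative is `L¹`-dominated (by itself). [folklore] -/
theorem LpDominated.of_isFourierPair {f : Site d → ℝ} {F : (Fin d → ℝ) → ℂ} (hf : ∀ x, 0 ≤ f x)
    (hF : IsFourierPair f F) : LpDominated f 1 := by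
  refine LpDominated.of_global hf (fun _ => le_rfl) hF ?_
  simp_rw [ENNReal.rpow_one]
  exact hF.integrableOn.2

/-! ### Chain (convolution) sums of dominated functions -/

/-- **Chains of dominated functions are uniformly bounded**: if `u_i ≥ 0` is
`L^{1/w_i}`-dominated (`w_i > 0`, `Σ w_i = 1`), then
`sup_a Σ_{y_1 + ⋯ + y_n = a} Π_i u_i(y_i) < ∞` — every finite part of the sum lives in a box, where
the diagram bound `HaraNorms.ofReal_sum_prod_le` of the dominating functions applies.
[cite: Hara2008, §4.1.1–§4.1.2 ((4.5)–(4.8), (4.13)–(4.14))] -/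
theorem exists_tsum_prod_le {n : ℕ} {u : Fin n → Site d → ℝ} (hu : ∀ i x, 0 ≤ u i x)
    {w : Fin n → ℝ} (hw : ∀ i, 0 < w i) (hw1 : ∑ i, w i = 1)
    (hdom : ∀ i, LpDominated (u i) (1 / w i)) :
    ∃ B : ℝ≥0∞, B < ⊤ ∧ ∀ a : Site d,
      ∑' y : {y : Fin n → Site d // ∑ i, y i = a}, ENNReal.ofReal (∏ i, u i (y.1 i)) ≤ B := by
  classical
  choose B hBlt hB using fun i => (hdom i).exists_bound
  refine ⟨(∑ i, ENNReal.ofReal (w i) * B i) / ENNReal.ofReal ((2 * Real.pi) ^ d), ?_, fun a => ?_⟩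
  · refine ENNReal.div_lt_top (ne_of_lt ?_) ?_
    · exact ENNReal.sum_lt_top.2 fun i _ => ENNReal.mul_lt_top ENNReal.ofReal_lt_top (hBlt i)
    · exact (ENNReal.ofReal_pos.2 (by positivity)).ne'
  · rw [ENNReal.tsum_eq_iSup_sum]
    refine iSup_le fun s => ?_
    set S : Finset (Fin n → Site d) := s.map (Function.Embedding.subtype _) with hS
    obtain ⟨L, hL⟩ := exists_subset_piFinset_box S
    -- dominating functions on the box `Λ_L`
    choose h F hh hle hF hFp using fun i => hB i L
    have hSf : S.filter (fun y => ∑ i, y i = a) = S := by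
      refine Finset.filter_true_of_mem fun y hy => ?_
      rw [hS, Finset.mem_map] at hy
      obtain ⟨z, -, rfl⟩ := hy
      exact z.2
    have hsum : ∑ y ∈ s, ENNReal.ofReal (∏ i, u i (y.1 i)) =
        ENNReal.ofReal (∑ y ∈ S with (∑ i, y i = a), ∏ i, u i (y i)) := by
      rw [hSf, hS, Finset.sum_map, ENNReal.ofReal_sum_of_nonneg fun y _ => Finset.prod_nonneg fun i _ => hu i _]
      rfl
    rw [hsum]
    calc ENNReal.ofReal (∑ y ∈ S with (∑ i, y i = a), ∏ i, u i (y i))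
        ≤ ENNReal.ofReal (∑ y ∈ S with (∑ i, y i = a), ∏ i, h i (y i)) := by
          refine ENNReal.ofReal_le_ofReal (Finset.sum_le_sum fun y hy => ?_)
          rw [Finset.mem_filter] at hy
          exact Finset.prod_le_prod (fun i _ => hu i _) fun i _ => hle i _ (hL y hy.1 i)
      _ ≤ (∑ i, ENNReal.ofReal (w i) * ∫⁻ k in cube d, ‖F i k‖ₑ ^ (1 / w i)) / ENNReal.ofReal ((2 * Real.pi) ^ d) :=
          ofReal_sum_prod_le hF hh hw hw1 a S
      _ ≤ (∑ i, ENNReal.ofReal (w i) * B i) / ENNReal.ofReal ((2 * Real.pi) ^ d) := by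
          gcongr with i _
          exact hFp i

/-- The pairs `(y, a - y)` parametrise `{(y₀, y₁) : y₀ + y₁ = a}`. [folklore] -/
def pairEquiv (a : Site d) : Site d ≃ {y : Fin 2 → Site d // ∑ i, y i = a} where
  toFun y := ⟨![y, a - y], by simp [Fin.sum_univ_two]⟩
  invFun z := z.1 0
  left_inv y := by simp
  right_inv z := by
    obtain ⟨z, hz⟩ := z
    rw [Fin.sum_univ_two] at hz
    ext i : 2
    fin_cases i
    · simp
    · simp only [Fin.mk_one, Matrix.cons_val_one, Matrix.cons_val_zero]
      rw [← hz]; abel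

/-- The pairs `(x, y)` parametrise `{(y₀, y₁, y₂) : y₀ + y₁ + y₂ = a}` through `(x, y - x, a - y)`.
[folklore] -/
def tripleEquiv (a : Site d) : Site d × Site d ≃ {y : Fin 3 → Site d // ∑ i, y i = a} where
  toFun xy := ⟨![xy.1, xy.2 - xy.1, a - xy.2], by simp [Fin.sum_univ_three]⟩
  invFun z := (z.1 0, z.1 0 + z.1 1)
  left_inv xy := by simp
  right_inv z := by
    obtain ⟨z, hz⟩ := z
    rw [Fin.sum_univ_three] at hz
    ext i : 2
    fin_cases i
    · simp
    · simp
    · simp only [Fin.reduceFinMk, Matrix.cons_val]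
      rw [← hz]; abel

/-- The triples `(x, y, z)` parametrise `{(y₀, …, y₃) : Σ y_i = a}` through
`(x, y - x, z - y, a - z)`. [folklore] -/
def quadEquiv (a : Site d) : Site d × Site d × Site d ≃ {y : Fin 4 → Site d // ∑ i, y i = a} where
  toFun s := ⟨![s.1, s.2.1 - s.1, s.2.2 - s.2.1, a - s.2.2], by simp [Fin.sum_univ_four]⟩
  invFun z := (z.1 0, z.1 0 + z.1 1, z.1 0 + z.1 1 + z.1 2)
  left_inv s := by simp
  right_inv z := by
    obtain ⟨z, hz⟩ := z
    rw [Fin.sum_univ_four] at hz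
    ext i : 2
    fin_cases i
    · simp
    · simp
    · simp
    · simp only [Fin.reduceFinMk, Matrix.cons_val]
      rw [← hz]; abel

/-- **Two-factor chains** (`W`-type): `sup_a Σ_y u₀(y) u₁(a - y) < ∞` for `u_i ≥ 0` dominated in
`L^{1/w₀}`, `L^{1/w₁}` (`w₀ + w₁ = 1`). [cite: Hara2008, §4.1.2 ((4.13): "finite if 4 + β + γ < d")] -/
theorem exists_tsum_pair_le {u₀ u₁ : Site d → ℝ} (hu₀ : ∀ x, 0 ≤ u₀ x) (hu₁ : ∀ x, 0 ≤ u₁ x)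
    {w₀ w₁ : ℝ} (hw₀ : 0 < w₀) (hw₁ : 0 < w₁) (hw : w₀ + w₁ = 1)
    (h₀ : LpDominated u₀ (1 / w₀)) (h₁ : LpDominated u₁ (1 / w₁)) :
    ∃ B : ℝ≥0∞, B < ⊤ ∧ ∀ a : Site d, ∑' y : Site d, ENNReal.ofReal (u₀ y * u₁ (a - y)) ≤ B := by
  obtain ⟨B, hB, hle⟩ := exists_tsum_prod_le (u := ![u₀, u₁]) (w := ![w₀, w₁])
    (fun i => by fin_cases i <;> assumption) (fun i => by fin_cases i <;> assumption)
    (by simp [Fin.sum_univ_two, hw]) (fun i => by fin_cases i <;> assumption)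
  refine ⟨B, hB, fun a => ?_⟩
  have h := hle a
  rw [← (pairEquiv a).tsum_eq] at h
  convert h using 3 with y
  simp [pairEquiv, Fin.prod_univ_two]

/-- **Three-factor chains** (`T`-type): `sup_a Σ_{x,y} u₀(x) u₁(y - x) u₂(a - y) < ∞`.
[cite: Hara2008, §4.1.2 ("T is handled in exactly the same way")] -/
theorem exists_tsum_triple_le {u₀ u₁ u₂ : Site d → ℝ} (hu₀ : ∀ x, 0 ≤ u₀ x) (hu₁ : ∀ x, 0 ≤ u₁ x)
    (hu₂ : ∀ x, 0 ≤ u₂ x) {w₀ w₁ w₂ : ℝ} (hw₀ : 0 < w₀) (hw₁ : 0 < w₁) (hw₂ : 0 < w₂)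
    (hw : w₀ + w₁ + w₂ = 1) (h₀ : LpDominated u₀ (1 / w₀)) (h₁ : LpDominated u₁ (1 / w₁))
    (h₂ : LpDominated u₂ (1 / w₂)) :
    ∃ B : ℝ≥0∞, B < ⊤ ∧ ∀ a : Site d,
      ∑' xy : Site d × Site d, ENNReal.ofReal (u₀ xy.1 * u₁ (xy.2 - xy.1) * u₂ (a - xy.2)) ≤ B := by
  obtain ⟨B, hB, hle⟩ := exists_tsum_prod_le (u := ![u₀, u₁, u₂]) (w := ![w₀, w₁, w₂])
    (fun i => by fin_cases i <;> assumption) (fun i => by fin_cases i <;> assumption)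
    (by simp [Fin.sum_univ_three, ← hw]) (fun i => by fin_cases i <;> assumption)
  refine ⟨B, hB, fun a => ?_⟩
  have h := hle a
  rw [← (tripleEquiv a).tsum_eq] at h
  convert h using 3 with xy
  simp [tripleEquiv, Fin.prod_univ_three, mul_assoc]

/-- **Four-factor chains** (`S`-type): `sup_a Σ_{x,y,z} u₀(x) u₁(y - x) u₂(z - y) u₃(a - z) < ∞`.
[cite: Hara2008, §4.1.2 ((4.13)–(4.14): "finite if 2 + γ + 6 < d")] -/
theorem exists_tsum_quad_le {u₀ u₁ u₂ u₃ : Site d → ℝ} (hu₀ : ∀ x, 0 ≤ u₀ x) (hu₁ : ∀ x, 0 ≤ u₁ x)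
    (hu₂ : ∀ x, 0 ≤ u₂ x) (hu₃ : ∀ x, 0 ≤ u₃ x) {w₀ w₁ w₂ w₃ : ℝ} (hw₀ : 0 < w₀) (hw₁ : 0 < w₁)
    (hw₂ : 0 < w₂) (hw₃ : 0 < w₃) (hw : w₀ + w₁ + w₂ + w₃ = 1) (h₀ : LpDominated u₀ (1 / w₀))
    (h₁ : LpDominated u₁ (1 / w₁)) (h₂ : LpDominated u₂ (1 / w₂)) (h₃ : LpDominated u₃ (1 / w₃)) :
    ∃ B : ℝ≥0∞, B < ⊤ ∧ ∀ a : Site d,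
      ∑' s : Site d × Site d × Site d,
        ENNReal.ofReal (u₀ s.1 * u₁ (s.2.1 - s.1) * u₂ (s.2.2 - s.2.1) * u₃ (a - s.2.2)) ≤ B := by
  obtain ⟨B, hB, hle⟩ := exists_tsum_prod_le (u := ![u₀, u₁, u₂, u₃]) (w := ![w₀, w₁, w₂, w₃])
    (fun i => by fin_cases i <;> assumption) (fun i => by fin_cases i <;> assumption)
    (by simp [Fin.sum_univ_four, ← hw, add_assoc]) (fun i => by fin_cases i <;> assumption)
  refine ⟨B, hB, fun a => ?_⟩
  have h := hle a
  rw [← (quadEquiv a).tsum_eq] at h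
  convert h using 3 with s
  simp [quadEquiv, Fin.prod_univ_four, mul_assoc]

end HaraNorms

/-! ### From Euclidean to coordinate weights -/

open HaraNorms

/-- `G_j^{(β)}(y) := |y_j|^β G(y)` with `G = τ_{p_c}(0,·)`: Hara's coordinate-weighted two-point
function. [cite: Hara2008, §4.1.1 ((4.1))] -/
def coordG (d : ℕ) (β : ℝ) (j : Fin d) (y : Site d) : ℝ :=
  |((y j : ℤ) : ℝ)| ^ β * tau d (criticalProbI d) 0 y

/-- `G_j^{(β)} ≥ 0`. [folklore] -/
theorem coordG_nonneg (d : ℕ) (β : ℝ) (j : Fin d) (y : Site d) : 0 ≤ coordG d β j y :=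
  mul_nonneg (Real.rpow_nonneg (abs_nonneg _) β) (tau_nonneg _ _ _)

/-- `G_j^{(0)} = G`. [folklore] -/
@[simp] theorem coordG_zero (d : ℕ) (j : Fin d) (y : Site d) : coordG d 0 j y = tau d (criticalProbI d) 0 y := by
  simp [coordG]

/-- **Hara's elementary inequality (4.3)** in the form `|x|^β ≤ (√d)^β Σ_j |x_j|^β` (`β ≥ 0`,
`d ≥ 1`; Hara prints `|x|^α ≤ c_α Σ_j |x_j|^α` with `c_α = d^{α-1} ∨ d^α`).
[cite: Hara2008, §4.1.1 ((4.3))] -/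
theorem euclidNorm_rpow_le_sum (hd : 1 ≤ d) (x : Site d) {β : ℝ} (hβ : 0 ≤ β) :
    euclidNorm x ^ β ≤ Real.sqrt d ^ β * ∑ j, |((x j : ℤ) : ℝ)| ^ β := by
  have hsum0 : 0 ≤ ∑ j, |((x j : ℤ) : ℝ)| ^ β :=
    Finset.sum_nonneg fun j _ => Real.rpow_nonneg (abs_nonneg _) β
  by_cases hx : x = 0
  · subst hx
    rcases hβ.eq_or_lt with rfl | hβ0
    · simp only [Real.rpow_zero, one_mul, Finset.sum_const, Finset.card_univ, Fintype.card_fin,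
        nsmul_eq_mul, mul_one]
      exact_mod_cast hd
    · rw [euclidNorm_zero', Real.zero_rpow hβ0.ne']
      exact mul_nonneg (Real.rpow_nonneg (Real.sqrt_nonneg _) β) hsum0
  · obtain ⟨l, -, hl⟩ := exists_coord_ge hd hx
    have h1 : euclidNorm x ≤ Real.sqrt d * |((x l : ℤ) : ℝ)| := (euclidNorm_le_jnorm x).trans hl
    calc euclidNorm x ^ β ≤ (Real.sqrt d * |((x l : ℤ) : ℝ)|) ^ β :=
          Real.rpow_le_rpow (euclidNorm_nonneg x) h1 hβ
      _ = Real.sqrt d ^ β * |((x l : ℤ) : ℝ)| ^ β := Real.mul_rpow (Real.sqrt_nonneg _) (abs_nonneg _)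
      _ ≤ Real.sqrt d ^ β * ∑ j, |((x j : ℤ) : ℝ)| ^ β := by
          gcongr
          exact Finset.single_le_sum (f := fun j => |((x j : ℤ) : ℝ)| ^ β)
            (fun j _ => Real.rpow_nonneg (abs_nonneg _) β) (Finset.mem_univ l)

/-- `G^{(β)}(y) ≤ (√d)^β Σ_j G_j^{(β)}(y)`: "it suffices to prove that `G_j^{(α)}(a)`,
`W_{jl}^{(β,γ)}(a), …` are finite uniformly in `a, b`". [cite: Hara2008, §4.1.1 ((4.3))] -/
theorem haraG_le_sum_coordG (hd : 1 ≤ d) {β : ℝ} (hβ : 0 ≤ β) (y : Site d) :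
    haraG d β y ≤ Real.sqrt d ^ β * ∑ j, coordG d β j y := by
  unfold haraG coordG
  rw [← Finset.sum_mul, ← mul_assoc]
  exact mul_le_mul_of_nonneg_right (euclidNorm_rpow_le_sum hd y hβ) (tau_nonneg _ _ _)

/-- Monotonicity of `G_j^{(β)}` in the exponent on `ℤ^d`: `|y_j|^β ≤ |y_j|^{β'}` for `0 < β ≤ β'`
(`|y_j| ∈ {0} ∪ [1, ∞)`). [cite: Hara2008, §4.1.3 (non-integer exponents below ⌊φ⌋)] -/
theorem coordG_mono {β β' : ℝ} (hβ : 0 < β) (hββ' : β ≤ β') (j : Fin d) (y : Site d) :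
    coordG d β j y ≤ coordG d β' j y := by
  unfold coordG
  refine mul_le_mul_of_nonneg_right ?_ (tau_nonneg _ _ _)
  rcases eq_or_ne (y j) 0 with h0 | h0
  · rw [h0]
    simp [Real.zero_rpow hβ.ne', Real.zero_rpow (lt_of_lt_of_le hβ hββ').ne']
  · have h1 : (1 : ℝ) ≤ |((y j : ℤ) : ℝ)| := by
      rw [← Int.cast_abs]; exact_mod_cast Int.one_le_abs h0
    exact Real.rpow_le_rpow_of_exponent_le h1 hββ'

/-- `L^p`-domination of `G_j^{(β')}` gives that of `G_j^{(β)}` for `0 < β ≤ β'`. [folklore] -/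
theorem HaraNorms.LpDominated.coordG_of_le {β β' : ℝ} (hβ : 0 < β) (hββ' : β ≤ β') {j : Fin d} {p : ℝ}
    (h : LpDominated (coordG d β' j) p) : LpDominated (coordG d β j) p :=
  h.mono fun y => coordG_mono hβ hββ' j y

/-! ### The clauses of Lemma 1.7 from coordinate information -/

/-- **`Ḡ^{(α)} < ∞` from coordinate bounds**: if `sup_y |y_j|^α G(y) < ∞` for every `j` then
`Ḡ^{(α)} < ∞`. [cite: Hara2008, §4.1.1 ((4.3)–(4.4))] -/
theorem haraGBar_lt_top_of_coordG_le (hd : 1 ≤ d) {α : ℝ} (hα : 0 ≤ α)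
    (h : ∀ j : Fin d, ∃ C : ℝ, ∀ y, coordG d α j y ≤ C) : haraGBar d α < ⊤ := by
  choose C hC using h
  refine haraGBar_lt_top_of_le (C := Real.sqrt d ^ α * ∑ j, C j) fun y => ?_
  refine (haraG_le_sum_coordG hd hα y).trans ?_
  gcongr with j _
  exact hC j y

/-- **`Ḡ^{(α)} < ∞` from `L¹` representatives of dominating functions** ("`G_j^{(α)}(a) ≤
∫ |Ĝ_j^{(α)}(k)| d^dk/(2π)^d`"). [cite: Hara2008, §4.1.2 ((4.9))] -/
theorem haraGBar_lt_top_of_lpDominated (hd : 1 ≤ d) {α : ℝ} (hα : 0 ≤ α)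
    (h : ∀ j : Fin d, LpDominated (coordG d α j) 1) : haraGBar d α < ⊤ :=
  haraGBar_lt_top_of_coordG_le hd hα fun j => (h j).exists_le

/-- Rearranging a `tsum` of a double finite sum (in `[0, ∞]`). [folklore] -/
theorem ENNReal.tsum_sum_sum {ι κ α : Type*} (s : Finset ι) (t : Finset κ) (f : ι → κ → α → ℝ≥0∞) :
    ∑' a, ∑ i ∈ s, ∑ j ∈ t, f i j a = ∑ i ∈ s, ∑ j ∈ t, ∑' a, f i j a := by
  rw [Summable.tsum_finsetSum fun i _ => ENNReal.summable]
  refine Finset.sum_congr rfl fun i _ => ?_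
  exact Summable.tsum_finsetSum fun j _ => ENNReal.summable

/-- **`W̄^{(β,γ)} < ∞` from `L^p`-dominated coordinate weights**: if every `G_j^{(β)}` is
`L^{1/w₀}`-dominated and every `G_l^{(γ)}` is `L^{1/w₁}`-dominated with `w₀ + w₁ = 1`, then
`W̄^{(β,γ)} < ∞` (Hara: `W_{jl}^{(β,γ)}(a) ≤ ∫ |Ĝ_j^{(β)} Ĝ_l^{(γ)}|`, Hölder, and (4.3)).
[cite: Hara2008, §4.1.1–§4.1.2 ((4.3), (4.5), (4.13))] -/
theorem haraWBar_lt_top_of_lpDominated (hd : 1 ≤ d) {β γ : ℝ} (hβ : 0 ≤ β) (hγ : 0 ≤ γ)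
    {w₀ w₁ : ℝ} (hw₀ : 0 < w₀) (hw₁ : 0 < w₁) (hw : w₀ + w₁ = 1)
    (h₀ : ∀ j : Fin d, LpDominated (coordG d β j) (1 / w₀))
    (h₁ : ∀ l : Fin d, LpDominated (coordG d γ l) (1 / w₁)) : haraWBar d β γ < ⊤ := by
  have hB : ∀ j l : Fin d, ∃ B : ℝ≥0∞, B < ⊤ ∧ ∀ a : Site d,
      ∑' y : Site d, ENNReal.ofReal (coordG d β j y * coordG d γ l (a - y)) ≤ B := fun j l =>
    exists_tsum_pair_le (coordG_nonneg d β j) (coordG_nonneg d γ l) hw₀ hw₁ hw (h₀ j) (h₁ l)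
  choose B hBlt hBle using hB
  set c : ℝ := Real.sqrt d ^ β * Real.sqrt d ^ γ with hc
  have hc0 : 0 ≤ c := mul_nonneg (Real.rpow_nonneg (Real.sqrt_nonneg _) β) (Real.rpow_nonneg (Real.sqrt_nonneg _) γ)
  have hpt : ∀ a y : Site d, ENNReal.ofReal (haraG d β y * haraG d γ (a - y)) ≤
      ENNReal.ofReal c * ∑ j, ∑ l, ENNReal.ofReal (coordG d β j y * coordG d γ l (a - y)) := by
    intro a y
    have h1 : haraG d β y * haraG d γ (a - y) ≤
        c * ∑ j, ∑ l, coordG d β j y * coordG d γ l (a - y) := by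
      calc haraG d β y * haraG d γ (a - y)
          ≤ (Real.sqrt d ^ β * ∑ j, coordG d β j y) * (Real.sqrt d ^ γ * ∑ l, coordG d γ l (a - y)) :=
            mul_le_mul (haraG_le_sum_coordG hd hβ y) (haraG_le_sum_coordG hd hγ (a - y)) (haraG_nonneg _ _ _)
              (mul_nonneg (Real.rpow_nonneg (Real.sqrt_nonneg _) β)
                (Finset.sum_nonneg fun j _ => coordG_nonneg d β j y))
        _ = c * ∑ j, ∑ l, coordG d β j y * coordG d γ l (a - y) := by
            rw [hc, mul_mul_mul_comm, Fintype.sum_mul_sum, Finset.mul_sum]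
    calc ENNReal.ofReal (haraG d β y * haraG d γ (a - y))
        ≤ ENNReal.ofReal (c * ∑ j, ∑ l, coordG d β j y * coordG d γ l (a - y)) := ENNReal.ofReal_le_ofReal h1
      _ = ENNReal.ofReal c * ∑ j, ∑ l, ENNReal.ofReal (coordG d β j y * coordG d γ l (a - y)) := by
          rw [ENNReal.ofReal_mul hc0, ENNReal.ofReal_sum_of_nonneg fun j _ =>
            Finset.sum_nonneg fun l _ => mul_nonneg (coordG_nonneg _ _ _ _) (coordG_nonneg _ _ _ _)]
          congr 1
          refine Finset.sum_congr rfl fun j _ => ?_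
          exact ENNReal.ofReal_sum_of_nonneg fun l _ => mul_nonneg (coordG_nonneg _ _ _ _) (coordG_nonneg _ _ _ _)
  have hbound : haraWBar d β γ ≤ ENNReal.ofReal c * ∑ j, ∑ l, B j l := by
    refine iSup_le fun a => ?_
    calc ∑' y, ENNReal.ofReal (haraG d β y * haraG d γ (a - y))
        ≤ ∑' y, ENNReal.ofReal c * ∑ j, ∑ l, ENNReal.ofReal (coordG d β j y * coordG d γ l (a - y)) :=
          ENNReal.tsum_le_tsum (hpt a)
      _ = ENNReal.ofReal c * ∑ j, ∑ l, ∑' y, ENNReal.ofReal (coordG d β j y * coordG d γ l (a - y)) := by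
          rw [ENNReal.tsum_mul_left, ENNReal.tsum_sum_sum]
      _ ≤ ENNReal.ofReal c * ∑ j, ∑ l, B j l := by
          gcongr with j _ l _
          exact hBle j l a
  refine lt_of_le_of_lt hbound (ENNReal.mul_lt_top ENNReal.ofReal_lt_top ?_)
  exact ENNReal.sum_lt_top.2 fun j _ => ENNReal.sum_lt_top.2 fun l _ => hBlt j l

/-- **`T̄^{(β,γ)} < ∞` from `L^p`-dominated coordinate weights** (three factors: `G_j^{(β)}`,
`G_l^{(γ)}` and `G` itself, Hölder weights `w₀ + w₁ + w₂ = 1`).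
[cite: Hara2008, §4.1.1–§4.1.2 ((4.3), (4.6), "T is handled in exactly the same way")] -/
theorem haraTBar_lt_top_of_lpDominated (hd : 1 ≤ d) {β γ : ℝ} (hβ : 0 ≤ β) (hγ : 0 ≤ γ)
    {w₀ w₁ w₂ : ℝ} (hw₀ : 0 < w₀) (hw₁ : 0 < w₁) (hw₂ : 0 < w₂) (hw : w₀ + w₁ + w₂ = 1)
    (h₀ : ∀ j : Fin d, LpDominated (coordG d β j) (1 / w₀))
    (h₁ : ∀ l : Fin d, LpDominated (coordG d γ l) (1 / w₁))
    (h₂ : LpDominated (fun y => tau d (criticalProbI d) 0 y) (1 / w₂)) : haraTBar d β γ < ⊤ := by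
  have hB : ∀ j l : Fin d, ∃ B : ℝ≥0∞, B < ⊤ ∧ ∀ a : Site d,
      ∑' xy : Site d × Site d, ENNReal.ofReal (coordG d β j xy.1 * coordG d γ l (xy.2 - xy.1) *
        tau d (criticalProbI d) 0 (a - xy.2)) ≤ B := fun j l =>
    exists_tsum_triple_le (coordG_nonneg d β j) (coordG_nonneg d γ l) (fun y => tau_nonneg _ _ _)
      hw₀ hw₁ hw₂ hw (h₀ j) (h₁ l) h₂
  choose B hBlt hBle using hB
  set c : ℝ := Real.sqrt d ^ β * Real.sqrt d ^ γ with hc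
  have hc0 : 0 ≤ c := mul_nonneg (Real.rpow_nonneg (Real.sqrt_nonneg _) β) (Real.rpow_nonneg (Real.sqrt_nonneg _) γ)
  have hpt : ∀ (a : Site d) (xy : Site d × Site d),
      ENNReal.ofReal (haraG d β xy.1 * haraG d γ (xy.2 - xy.1) * tau d (criticalProbI d) 0 (a - xy.2)) ≤
      ENNReal.ofReal c * ∑ j, ∑ l, ENNReal.ofReal (coordG d β j xy.1 * coordG d γ l (xy.2 - xy.1) *
        tau d (criticalProbI d) 0 (a - xy.2)) := by
    intro a xy
    have hτ := tau_nonneg (criticalProbI d) 0 (a - xy.2)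
    have h1 : haraG d β xy.1 * haraG d γ (xy.2 - xy.1) * tau d (criticalProbI d) 0 (a - xy.2) ≤
        c * ∑ j, ∑ l, coordG d β j xy.1 * coordG d γ l (xy.2 - xy.1) * tau d (criticalProbI d) 0 (a - xy.2) := by
      have h2 : haraG d β xy.1 * haraG d γ (xy.2 - xy.1) ≤
          c * ∑ j, ∑ l, coordG d β j xy.1 * coordG d γ l (xy.2 - xy.1) := by
        calc haraG d β xy.1 * haraG d γ (xy.2 - xy.1)
            ≤ (Real.sqrt d ^ β * ∑ j, coordG d β j xy.1) * (Real.sqrt d ^ γ * ∑ l, coordG d γ l (xy.2 - xy.1)) :=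
              mul_le_mul (haraG_le_sum_coordG hd hβ _) (haraG_le_sum_coordG hd hγ _) (haraG_nonneg _ _ _)
                (mul_nonneg (Real.rpow_nonneg (Real.sqrt_nonneg _) β)
                  (Finset.sum_nonneg fun j _ => coordG_nonneg d β j _))
          _ = c * ∑ j, ∑ l, coordG d β j xy.1 * coordG d γ l (xy.2 - xy.1) := by
              rw [hc, mul_mul_mul_comm, Fintype.sum_mul_sum, Finset.mul_sum]
      calc haraG d β xy.1 * haraG d γ (xy.2 - xy.1) * tau d (criticalProbI d) 0 (a - xy.2)
          ≤ (c * ∑ j, ∑ l, coordG d β j xy.1 * coordG d γ l (xy.2 - xy.1)) * tau d (criticalProbI d) 0 (a - xy.2) :=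
            mul_le_mul_of_nonneg_right h2 hτ
        _ = c * ∑ j, ∑ l, coordG d β j xy.1 * coordG d γ l (xy.2 - xy.1) * tau d (criticalProbI d) 0 (a - xy.2) := by
            rw [mul_assoc, Finset.sum_mul]
            congr 1
            exact Finset.sum_congr rfl fun j _ => Finset.sum_mul _ _ _
    have hnn : ∀ j l, 0 ≤ coordG d β j xy.1 * coordG d γ l (xy.2 - xy.1) * tau d (criticalProbI d) 0 (a - xy.2) :=
      fun j l => mul_nonneg (mul_nonneg (coordG_nonneg _ _ _ _) (coordG_nonneg _ _ _ _)) hτ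
    calc ENNReal.ofReal (haraG d β xy.1 * haraG d γ (xy.2 - xy.1) * tau d (criticalProbI d) 0 (a - xy.2))
        ≤ ENNReal.ofReal (c * ∑ j, ∑ l, coordG d β j xy.1 * coordG d γ l (xy.2 - xy.1) *
            tau d (criticalProbI d) 0 (a - xy.2)) := ENNReal.ofReal_le_ofReal h1
      _ = ENNReal.ofReal c * ∑ j, ∑ l, ENNReal.ofReal (coordG d β j xy.1 * coordG d γ l (xy.2 - xy.1) *
            tau d (criticalProbI d) 0 (a - xy.2)) := by
          rw [ENNReal.ofReal_mul hc0, ENNReal.ofReal_sum_of_nonneg fun j _ =>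
            Finset.sum_nonneg fun l _ => hnn j l]
          congr 1
          refine Finset.sum_congr rfl fun j _ => ?_
          exact ENNReal.ofReal_sum_of_nonneg fun l _ => hnn j l
  have hbound : haraTBar d β γ ≤ ENNReal.ofReal c * ∑ j, ∑ l, B j l := by
    refine iSup_le fun a => ?_
    calc ∑' xy : Site d × Site d, ENNReal.ofReal (haraG d β xy.1 * haraG d γ (xy.2 - xy.1) *
          tau d (criticalProbI d) 0 (a - xy.2))
        ≤ ∑' xy : Site d × Site d, ENNReal.ofReal c * ∑ j, ∑ l, ENNReal.ofReal (coordG d β j xy.1 *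
            coordG d γ l (xy.2 - xy.1) * tau d (criticalProbI d) 0 (a - xy.2)) := ENNReal.tsum_le_tsum (hpt a)
      _ = ENNReal.ofReal c * ∑ j, ∑ l, ∑' xy : Site d × Site d, ENNReal.ofReal (coordG d β j xy.1 *
            coordG d γ l (xy.2 - xy.1) * tau d (criticalProbI d) 0 (a - xy.2)) := by
          rw [ENNReal.tsum_mul_left, ENNReal.tsum_sum_sum]
      _ ≤ ENNReal.ofReal c * ∑ j, ∑ l, B j l := by
          gcongr with j _ l _
          exact hBle j l a
  refine lt_of_le_of_lt hbound (ENNReal.mul_lt_top ENNReal.ofReal_lt_top ?_)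
  exact ENNReal.sum_lt_top.2 fun j _ => ENNReal.sum_lt_top.2 fun l _ => hBlt j l

/-- **`S̄^{(γ)} < ∞` from `L^p`-dominated coordinate weights** (four factors: `G_j^{(γ)}` and three
copies of `G`). [cite: Hara2008, §4.1.1–§4.1.2 ((4.3), (4.7), (4.14))] -/
theorem haraSBar_lt_top_of_lpDominated (hd : 1 ≤ d) {γ : ℝ} (hγ : 0 ≤ γ)
    {w₀ w₁ w₂ w₃ : ℝ} (hw₀ : 0 < w₀) (hw₁ : 0 < w₁) (hw₂ : 0 < w₂) (hw₃ : 0 < w₃)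
    (hw : w₀ + w₁ + w₂ + w₃ = 1)
    (h₀ : ∀ j : Fin d, LpDominated (coordG d γ j) (1 / w₀))
    (h₁ : LpDominated (fun y => tau d (criticalProbI d) 0 y) (1 / w₁))
    (h₂ : LpDominated (fun y => tau d (criticalProbI d) 0 y) (1 / w₂))
    (h₃ : LpDominated (fun y => tau d (criticalProbI d) 0 y) (1 / w₃)) : haraSBar d γ < ⊤ := by
  set τ₀ : Site d → ℝ := fun y => tau d (criticalProbI d) 0 y with hτ₀
  have hτnn : ∀ y, 0 ≤ τ₀ y := fun y => tau_nonneg _ _ _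
  have hB : ∀ j : Fin d, ∃ B : ℝ≥0∞, B < ⊤ ∧ ∀ a : Site d,
      ∑' s : Site d × Site d × Site d, ENNReal.ofReal (coordG d γ j s.1 * τ₀ (s.2.1 - s.1) *
        τ₀ (s.2.2 - s.2.1) * τ₀ (a - s.2.2)) ≤ B := fun j =>
    exists_tsum_quad_le (coordG_nonneg d γ j) hτnn hτnn hτnn hw₀ hw₁ hw₂ hw₃ hw (h₀ j) h₁ h₂ h₃
  choose B hBlt hBle using hB
  set c : ℝ := Real.sqrt d ^ γ with hc
  have hc0 : 0 ≤ c := Real.rpow_nonneg (Real.sqrt_nonneg _) γ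
  have hpt : ∀ (a : Site d) (s : Site d × Site d × Site d),
      ENNReal.ofReal (haraG d γ s.1 * τ₀ (s.2.1 - s.1) * τ₀ (s.2.2 - s.2.1) * τ₀ (a - s.2.2)) ≤
      ENNReal.ofReal c * ∑ j, ENNReal.ofReal (coordG d γ j s.1 * τ₀ (s.2.1 - s.1) *
        τ₀ (s.2.2 - s.2.1) * τ₀ (a - s.2.2)) := by
    intro a s
    set R : ℝ := τ₀ (s.2.1 - s.1) * τ₀ (s.2.2 - s.2.1) * τ₀ (a - s.2.2) with hR
    have hR0 : 0 ≤ R := mul_nonneg (mul_nonneg (hτnn _) (hτnn _)) (hτnn _)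
    have hre : ∀ u : ℝ, u * τ₀ (s.2.1 - s.1) * τ₀ (s.2.2 - s.2.1) * τ₀ (a - s.2.2) = u * R := fun u => by
      rw [hR]; ring
    simp_rw [hre]
    have h1 : haraG d γ s.1 * R ≤ c * ∑ j, coordG d γ j s.1 * R := by
      calc haraG d γ s.1 * R ≤ (c * ∑ j, coordG d γ j s.1) * R :=
            mul_le_mul_of_nonneg_right (haraG_le_sum_coordG hd hγ _) hR0
        _ = c * ∑ j, coordG d γ j s.1 * R := by rw [mul_assoc, Finset.sum_mul]
    calc ENNReal.ofReal (haraG d γ s.1 * R) ≤ ENNReal.ofReal (c * ∑ j, coordG d γ j s.1 * R) :=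
          ENNReal.ofReal_le_ofReal h1
      _ = ENNReal.ofReal c * ∑ j, ENNReal.ofReal (coordG d γ j s.1 * R) := by
          rw [ENNReal.ofReal_mul hc0, ENNReal.ofReal_sum_of_nonneg fun j _ =>
            mul_nonneg (coordG_nonneg _ _ _ _) hR0]
  have hbound : haraSBar d γ ≤ ENNReal.ofReal c * ∑ j, B j := by
    refine iSup_le fun a => ?_
    calc ∑' s : Site d × Site d × Site d, ENNReal.ofReal (haraG d γ s.1 * τ₀ (s.2.1 - s.1) *
          τ₀ (s.2.2 - s.2.1) * τ₀ (a - s.2.2))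
        ≤ ∑' s : Site d × Site d × Site d, ENNReal.ofReal c * ∑ j, ENNReal.ofReal (coordG d γ j s.1 *
            τ₀ (s.2.1 - s.1) * τ₀ (s.2.2 - s.2.1) * τ₀ (a - s.2.2)) := ENNReal.tsum_le_tsum (hpt a)
      _ = ENNReal.ofReal c * ∑ j, ∑' s : Site d × Site d × Site d, ENNReal.ofReal (coordG d γ j s.1 *
            τ₀ (s.2.1 - s.1) * τ₀ (s.2.2 - s.2.1) * τ₀ (a - s.2.2)) := by
          rw [ENNReal.tsum_mul_left, Summable.tsum_finsetSum fun j _ => ENNReal.summable]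
      _ ≤ ENNReal.ofReal c * ∑ j, B j := by
          gcongr with j _
          exact hBle j a
  refine lt_of_le_of_lt hbound (ENNReal.mul_lt_top ENNReal.ofReal_lt_top ?_)
  exact ENNReal.sum_lt_top.2 fun j _ => hBlt j

/-! ### `H̄^{(β)}` from `W̄` and `S̄` in `x`-space -/

section HBar

/-- `τ_{p_c}(0, -x) = τ_{p_c}(0, x)`. [folklore] -/
theorem HaraNorms.tau0_neg (x : Site d) : tau d (criticalProbI d) 0 (-x) = tau d (criticalProbI d) 0 x := by
  have h := tau_add_right (criticalProbI d) 0 (-x) x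
  rw [zero_add, neg_add_cancel] at h
  rw [← h, tau_comm]

/-- `τ_{p_c}(0, x - y) = τ_{p_c}(0, y - x)`. [folklore] -/
theorem HaraNorms.tau0_sub_comm (x y : Site d) :
    tau d (criticalProbI d) 0 (x - y) = tau d (criticalProbI d) 0 (y - x) := by
  rw [← neg_sub, HaraNorms.tau0_neg]

/-- A bubble is at most `W̄^{(0,0)}`: `Σ_y τ(y) τ(c - y) ≤ W̄^{(0,0)}`. [folklore] -/
theorem HaraNorms.tsum_tau_mul_tau_le (c : Site d) :
    ∑' y, ENNReal.ofReal (tau d (criticalProbI d) 0 y) * ENNReal.ofReal (tau d (criticalProbI d) 0 (c - y)) ≤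
      haraWBar d 0 0 := by
  refine le_iSup_of_le (f := fun a : Site d => ∑' y : Site d, ENNReal.ofReal (haraG d 0 y * haraG d 0 (a - y))) c
    (le_of_eq (tsum_congr fun y => ?_))
  rw [haraG_zero, haraG_zero, ENNReal.ofReal_mul (tau_nonneg _ _ _)]

/-- `Σ_y G^{(β)}(y) τ(c - y) ≤ W̄^{(β,0)}`. [folklore] -/
theorem HaraNorms.tsum_haraG_mul_tau_le (β : ℝ) (c : Site d) :
    ∑' y, ENNReal.ofReal (haraG d β y) * ENNReal.ofReal (tau d (criticalProbI d) 0 (c - y)) ≤ haraWBar d β 0 := by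
  refine le_iSup_of_le (f := fun a : Site d => ∑' y : Site d, ENNReal.ofReal (haraG d β y * haraG d 0 (a - y))) c
    (le_of_eq (tsum_congr fun y => ?_))
  rw [haraG_zero, ENNReal.ofReal_mul (haraG_nonneg _ _ _)]

/-- A square is at most `S̄^{(0)}`: `Σ_{u,v,w} τ(u) τ(v-u) τ(w-v) τ(a-w) ≤ S̄^{(0)}`. [folklore] -/
theorem HaraNorms.tsum_square_le (a : Site d) :
    ∑' u, ∑' v, ∑' w, ENNReal.ofReal (tau d (criticalProbI d) 0 u) *
      ENNReal.ofReal (tau d (criticalProbI d) 0 (v - u)) * ENNReal.ofReal (tau d (criticalProbI d) 0 (w - v)) *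
      ENNReal.ofReal (tau d (criticalProbI d) 0 (a - w)) ≤ haraSBar d 0 := by
  refine le_iSup_of_le (f := fun a : Site d => ∑' xyz : Site d × Site d × Site d,
    ENNReal.ofReal (haraG d 0 xyz.1 * tau d (criticalProbI d) 0 (xyz.2.1 - xyz.1) *
      tau d (criticalProbI d) 0 (xyz.2.2 - xyz.2.1) * tau d (criticalProbI d) 0 (a - xyz.2.2))) a (le_of_eq ?_)
  rw [ENNReal.tsum_prod']
  refine tsum_congr fun u => ?_
  rw [ENNReal.tsum_prod']
  refine tsum_congr fun v => tsum_congr fun w => ?_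
  rw [haraG_zero, ENNReal.ofReal_mul (mul_nonneg (mul_nonneg (tau_nonneg _ _ _) (tau_nonneg _ _ _)) (tau_nonneg _ _ _)),
    ENNReal.ofReal_mul (mul_nonneg (tau_nonneg _ _ _) (tau_nonneg _ _ _)), ENNReal.ofReal_mul (tau_nonneg _ _ _)]

/-- **`H̄^{(β)} ≤ W̄^{(β,0)} · W̄^{(0,0)} · S̄^{(0)}`** — the `x`-space substitute for Hara's
`3d`-dimensional Fourier integral (4.8)/(4.15): in
`H^{(β)}(a,b) = Σ G(z)G(u)G(x-u)G^{(β)}(x)G(y-x)G(v-u)G(z+a-v)G(y+b-v)` bound the bubble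
`Σ_y G(y-x)G(y+b-v) ≤ W̄^{(0,0)}`, then `Σ_x G^{(β)}(x)G(x-u) ≤ W̄^{(β,0)}`, and the remaining
`Σ_{u,v,z} G(u)G(v-u)G(z+a-v)G(z)` is the square `S^{(0)}(a) ≤ S̄^{(0)}` (Tonelli throughout).
[cite: Hara2008, §1.1 (definition of H^{(β)}) and §4.1.2 ("H requires more care")] -/
theorem haraHBar_le_mul (β : ℝ) : haraHBar d β ≤ haraWBar d β 0 * haraWBar d 0 0 * haraSBar d 0 := by
  set T : Site d → ℝ≥0∞ := fun w => ENNReal.ofReal (tau d (criticalProbI d) 0 w) with hT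
  set Gb : Site d → ℝ≥0∞ := fun x => ENNReal.ofReal (haraG d β x) with hGb
  have hTneg : ∀ w, T (-w) = T w := fun w => by simp only [hT, HaraNorms.tau0_neg]
  -- the summand, as a product in `[0, ∞]`
  set F : Site d → Site d → Site d → Site d → Site d → Site d → Site d → ℝ≥0∞ :=
    fun a b x y z u v => T z * T u * T (x - u) * Gb x * T (y - x) * T (v - u) * T (z + a - v) * T (y + b - v) with hF
  have hsummand : ∀ (a b : Site d) (s : Site d × Site d × Site d × Site d × Site d),
      ENNReal.ofReal (tau d (criticalProbI d) 0 s.2.2.1 * tau d (criticalProbI d) 0 s.2.2.2.1 *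
        tau d (criticalProbI d) 0 (s.1 - s.2.2.2.1) * haraG d β s.1 *
        tau d (criticalProbI d) 0 (s.2.1 - s.1) * tau d (criticalProbI d) 0 (s.2.2.2.2 - s.2.2.2.1) *
        tau d (criticalProbI d) 0 (s.2.2.1 + a - s.2.2.2.2) *
        tau d (criticalProbI d) 0 (s.2.1 + b - s.2.2.2.2)) = F a b s.1 s.2.1 s.2.2.1 s.2.2.2.1 s.2.2.2.2 := by
    intro a b s
    simp only [hF, hT, hGb]
    rw [ENNReal.ofReal_mul' (tau_nonneg _ _ _), ENNReal.ofReal_mul' (tau_nonneg _ _ _),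
      ENNReal.ofReal_mul' (tau_nonneg _ _ _), ENNReal.ofReal_mul' (tau_nonneg _ _ _),
      ENNReal.ofReal_mul' (haraG_nonneg _ _ _), ENNReal.ofReal_mul' (tau_nonneg _ _ _),
      ENNReal.ofReal_mul' (tau_nonneg _ _ _)]
  -- the inner `(x, y)` sum for fixed `z, u, v`
  have hinner : ∀ a b z u v : Site d,
      ∑' x, ∑' y, F a b x y z u v ≤ T z * T u * T (v - u) * T (z + a - v) * (haraWBar d β 0 * haraWBar d 0 0) := by
    intro a b z u v
    have hy : ∀ x, ∑' y, T (y - x) * T (y + b - v) ≤ haraWBar d 0 0 := by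
      intro x
      have hshift : ∑' y, T (y - x) * T (y + b - v) = ∑' y', T y' * T ((v - x - b) - y') := by
        rw [← (Equiv.subRight x).tsum_eq (fun y' => T y' * T ((v - x - b) - y'))]
        refine tsum_congr fun y => ?_
        simp only [Equiv.subRight_apply]
        rw [← hTneg ((v - x - b) - (y - x))]
        congr 2
        abel
      rw [hshift]
      exact HaraNorms.tsum_tau_mul_tau_le _
    have hx : ∑' x, Gb x * T (x - u) ≤ haraWBar d β 0 := by
      calc ∑' x, Gb x * T (x - u) = ∑' x, Gb x * T (u - x) := tsum_congr fun x => by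
            simp only [hT, HaraNorms.tau0_sub_comm x u]
        _ ≤ haraWBar d β 0 := HaraNorms.tsum_haraG_mul_tau_le β u
    calc ∑' x, ∑' y, F a b x y z u v
        = ∑' x, T z * T u * T (v - u) * T (z + a - v) * (Gb x * T (x - u)) * ∑' y, T (y - x) * T (y + b - v) := by
          refine tsum_congr fun x => ?_
          rw [← ENNReal.tsum_mul_left]
          refine tsum_congr fun y => ?_
          simp only [hF]
          ring
      _ ≤ ∑' x, T z * T u * T (v - u) * T (z + a - v) * (Gb x * T (x - u)) * haraWBar d 0 0 := by
          gcongr with x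
          exact hy x
      _ = T z * T u * T (v - u) * T (z + a - v) * haraWBar d 0 0 * ∑' x, Gb x * T (x - u) := by
          rw [← ENNReal.tsum_mul_left]
          refine tsum_congr fun x => ?_
          ring
      _ ≤ T z * T u * T (v - u) * T (z + a - v) * haraWBar d 0 0 * haraWBar d β 0 := by
          gcongr
      _ = T z * T u * T (v - u) * T (z + a - v) * (haraWBar d β 0 * haraWBar d 0 0) := by ring
  -- the outer `(u, v, z)` sum is a square
  have houter : ∀ a : Site d,
      ∑' uv : Site d × Site d, ∑' z, T z * T uv.1 * T (uv.2 - uv.1) * T (z + a - uv.2) ≤ haraSBar d 0 := by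
    intro a
    calc ∑' uv : Site d × Site d, ∑' z, T z * T uv.1 * T (uv.2 - uv.1) * T (z + a - uv.2)
        = ∑' uv : Site d × Site d, ∑' w, T uv.1 * T (uv.2 - uv.1) * T (w - uv.2) * T (a - w) := by
          refine tsum_congr fun uv => ?_
          rw [← (Equiv.addRight a).tsum_eq (fun w => T uv.1 * T (uv.2 - uv.1) * T (w - uv.2) * T (a - w))]
          refine tsum_congr fun z => ?_
          simp only [Equiv.coe_addRight]
          rw [← hTneg (a - (z + a)), show -(a - (z + a)) = z by abel]
          ring
      _ = ∑' u, ∑' v, ∑' w, T u * T (v - u) * T (w - v) * T (a - w) := by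
          rw [ENNReal.tsum_prod']
      _ ≤ haraSBar d 0 := HaraNorms.tsum_square_le a
  -- assemble
  refine iSup_le fun ab => ?_
  obtain ⟨a, b⟩ := ab
  set e := Equiv.prodAssoc (Site d) (Site d) (Site d × Site d × Site d) with he
  calc ∑' s : Site d × Site d × Site d × Site d × Site d,
        ENNReal.ofReal (tau d (criticalProbI d) 0 s.2.2.1 * tau d (criticalProbI d) 0 s.2.2.2.1 *
          tau d (criticalProbI d) 0 (s.1 - s.2.2.2.1) * haraG d β s.1 *
          tau d (criticalProbI d) 0 (s.2.1 - s.1) * tau d (criticalProbI d) 0 (s.2.2.2.2 - s.2.2.2.1) *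
          tau d (criticalProbI d) 0 (s.2.2.1 + (a, b).1 - s.2.2.2.2) *
          tau d (criticalProbI d) 0 (s.2.1 + (a, b).2 - s.2.2.2.2))
      = ∑' s : Site d × Site d × Site d × Site d × Site d, F a b s.1 s.2.1 s.2.2.1 s.2.2.2.1 s.2.2.2.2 :=
        tsum_congr fun s => hsummand a b s
    _ = ∑' p : (Site d × Site d) × (Site d × Site d × Site d), F a b p.1.1 p.1.2 p.2.1 p.2.2.1 p.2.2.2 := by
        rw [← e.tsum_eq]
        rfl
    _ = ∑' zuv : Site d × Site d × Site d, ∑' xy : Site d × Site d, F a b xy.1 xy.2 zuv.1 zuv.2.1 zuv.2.2 := by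
        rw [ENNReal.tsum_prod', ENNReal.tsum_comm]
    _ = ∑' z, ∑' uv : Site d × Site d, ∑' xy : Site d × Site d, F a b xy.1 xy.2 z uv.1 uv.2 := by
        rw [ENNReal.tsum_prod']
    _ = ∑' uv : Site d × Site d, ∑' z, ∑' xy : Site d × Site d, F a b xy.1 xy.2 z uv.1 uv.2 := ENNReal.tsum_comm
    _ ≤ ∑' uv : Site d × Site d, ∑' z, T z * T uv.1 * T (uv.2 - uv.1) * T (z + a - uv.2) *
          (haraWBar d β 0 * haraWBar d 0 0) := by
        refine ENNReal.tsum_le_tsum fun uv => ENNReal.tsum_le_tsum fun z => ?_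
        rw [ENNReal.tsum_prod']
        exact hinner a b z uv.1 uv.2
    _ = (∑' uv : Site d × Site d, ∑' z, T z * T uv.1 * T (uv.2 - uv.1) * T (z + a - uv.2)) *
          (haraWBar d β 0 * haraWBar d 0 0) := by
        rw [← ENNReal.tsum_mul_right]
        refine tsum_congr fun uv => ?_
        rw [← ENNReal.tsum_mul_right]
    _ ≤ haraSBar d 0 * (haraWBar d β 0 * haraWBar d 0 0) := by
        gcongr
        exact houter a
    _ = haraWBar d β 0 * haraWBar d 0 0 * haraSBar d 0 := by ring

/-- **The `H̄`-clause from the `W̄`- and `S̄`-clauses**: `W̄^{(β,0)}, W̄^{(0,0)}, S̄^{(0)} < ∞` give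
`H̄^{(β)} < ∞`. [cite: Hara2008, Lemma 1.7 ((1.34): H̄^{(β)} < ∞ if β ≤ ⌊φ⌋, β < d-4, d > 6)] -/
theorem haraHBar_lt_top_of_bars {β : ℝ} (hW : haraWBar d β 0 < ⊤) (hW0 : haraWBar d 0 0 < ⊤)
    (hS : haraSBar d 0 < ⊤) : haraHBar d β < ⊤ :=
  lt_of_le_of_lt (haraHBar_le_mul β) (ENNReal.mul_lt_top (ENNReal.mul_lt_top hW hW0) hS)

end HBar

/-! ### The integer engine: `G_j^{(2b)}` has the `L^p` representative `(-1)^b ∂_j^{2b} Ĝ` -/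

section IntegerEngine

variable {Φ : Site d → ℝ}

/-- **Even integer weights are `L^p`-dominated for `(2 + 2b) p < d`**: for a lace-expansion
coefficient with `Σ_x (1+|x|)^M |Π(x)| < ∞` (`M ≥ 2`), `2b ≤ M`, `p ≥ 1` and `(2 + 2b)p < d`, the
function `G_j^{(2b)} = x_j^{2b} τ_{p_c}(0,x)` has the Fourier representative `(-1)^b ∂_j^{2b} Ĝ`
((4.8)) with `∫ |∂_j^{2b} Ĝ|^p ≤ ∫ C^p |k|^{-(2+2b)p} < ∞` (Lemma 4.1) — Hara's "counting powers of
`k` and checking integrability". [cite: Hara2008, §4.1.2 ((4.8)–(4.9), (4.13)–(4.14)) and Lemma 4.1] -/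
theorem IsLaceCoefficientPc.lpDominated_coordG_even (h : IsLaceCoefficientPc d Φ) {M : ℕ} (hM2 : 2 ≤ M)
    (hmom : Summable fun x => (1 + euclidNorm x) ^ M * |Φ x|) (j : Fin d) {b : ℕ} (hb : 2 * b ≤ M)
    {p : ℝ} (hp : 1 ≤ p) (hpd : (2 + 2 * b) * p < d) :
    LpDominated (coordG d (2 * (b : ℝ)) j) p := by
  set J : Site d → ℝ := laceKernel (criticalProbI d) Φ with hJdef
  set g : Site d → ℝ := laceSource Φ with hgdef
  obtain ⟨c₀, hc₀, hlow⟩ := h.exists_knorm_sq_le_norm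
  have hJ : Summable fun x => (1 + euclidNorm x) ^ M * |J x| := summable_moment_laceKernel hmom _
  have hg : Summable fun x => (1 + euclidNorm x) ^ M * |g x| := summable_moment_laceSource hmom
  have hJs : IsZdSymmetric J := isZdSymmetric_laceKernel h.symm _
  have hp0 : 0 < p := lt_of_lt_of_le one_pos hp
  have hbd_real : ((2 + 2 * b : ℕ) : ℝ) < d := by
    have h1 : ((2 + 2 * b : ℕ) : ℝ) * 1 ≤ (2 + 2 * b) * p := by push_cast; gcongr
    push_cast at h1 ⊢
    linarith
  have hbd : 2 * b + 2 < d := by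
    have h1 : (2 + 2 * b : ℕ) < d := by exact_mod_cast hbd_real
    omega
  have hd : 1 ≤ d := by omega
  set sD : (Fin d → ℝ) → ℂ := sliceDeriv (kspaceTwoPoint J g) j (2 * b) with hsD
  set F : (Fin d → ℝ) → ℂ := fun k => (-1 : ℂ) ^ b * sD k with hFdef
  have hint : IntegrableOn sD (cube d) :=
    integrableOn_sliceDeriv_kspaceTwoPoint hM2 hJ hg hJs hc₀ hlow j hb hbd
  -- the Fourier pair
  have hpair : IsFourierPair (coordG d (2 * (b : ℝ)) j) F := by
    refine ⟨show IntegrableOn (fun k => (-1 : ℂ) ^ b * sD k) (cube d) volume from hint.const_mul ((-1 : ℂ) ^ b), fun y => ?_⟩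
    have hid := h.pow_mul_tau_eq_integral hM2 hmom j hb hbd y
    have h2π : ((2 * Real.pi : ℂ)) ^ d ≠ 0 := pow_ne_zero _ (by exact_mod_cast Real.two_pi_pos.ne')
    have hev : coordG d (2 * (b : ℝ)) j y = ((y j : ℤ) : ℝ) ^ (2 * b) * tau d (criticalProbI d) 0 y := by
      rw [coordG, show (2 * (b : ℝ)) = ((2 * b : ℕ) : ℝ) by push_cast; ring, Real.rpow_natCast, pow_mul,
        sq_abs, ← pow_mul]
    have hpull : ∫ k in cube d, Complex.exp (Complex.I * (kdot k y : ℂ)) * ((-1 : ℂ) ^ b * sD k) =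
        (-1 : ℂ) ^ b * ∫ k in cube d, Complex.exp (Complex.I * (kdot k y : ℂ)) * sD k := by
      rw [← integral_const_mul]
      refine setIntegral_congr_fun (measurableSet_cube d) fun k _ => ?_
      ring
    rw [hev, eq_div_iff h2π]
    show _ = ∫ k in cube d, Complex.exp (Complex.I * (kdot k y : ℂ)) * ((-1 : ℂ) ^ b * sD k)
    rw [hpull]
    refine Eq.trans ?_ hid
    push_cast
    ring
  -- the `L^p` bound
  obtain ⟨C, hC⟩ := h.exists_norm_sliceDeriv_le hM2 hmom j hb
  set q : ℝ := (2 + 2 * b) * p with hq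
  have hq0 : 0 ≤ q := by positivity
  have hΨ : IntegrableOn (fun k : Fin d → ℝ => |C| ^ p * knorm k ^ (-q)) (cube d) :=
    (integrableOn_knorm_rpow_neg hd hq0 hpd).const_mul _
  refine LpDominated.of_global (coordG_nonneg d _ j) (fun _ => le_rfl) hpair ?_
  have hle : ∀ᵐ k ∂(volume.restrict (cube d)), ‖F k‖ₑ ^ p ≤ ENNReal.ofReal (|C| ^ p * knorm k ^ (-q)) := by
    filter_upwards [ae_restrict_mem (measurableSet_cube d), ae_restrict_cube_ne_zero hd] with k hk hk0
    have hkn : 0 < knorm k := knorm_pos_of_ne_zero hk0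
    have h1 : ‖F k‖ ≤ |C| / knorm k ^ (2 + 2 * b) := by
      rw [hFdef]
      simp only [norm_mul, norm_pow, norm_neg, norm_one, one_pow, one_mul]
      exact (hC k hk hk0).trans (div_le_div_of_nonneg_right (le_abs_self C) (pow_nonneg hkn.le _))
    have h2 : |C| / knorm k ^ (2 + 2 * b) = |C| * knorm k ^ (-((2 + 2 * b : ℕ) : ℝ)) := by
      rw [Real.rpow_neg hkn.le, Real.rpow_natCast, div_eq_mul_inv]
    rw [← ofReal_norm, ENNReal.ofReal_rpow_of_nonneg (norm_nonneg _) hp0.le]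
    refine ENNReal.ofReal_le_ofReal ?_
    calc ‖F k‖ ^ p ≤ (|C| * knorm k ^ (-((2 + 2 * b : ℕ) : ℝ))) ^ p := by
          rw [← h2]; exact Real.rpow_le_rpow (norm_nonneg _) h1 hp0.le
      _ = |C| ^ p * knorm k ^ (-q) := by
          rw [Real.mul_rpow (abs_nonneg C) (Real.rpow_nonneg hkn.le _), ← Real.rpow_mul hkn.le]
          congr 2
          rw [hq]; push_cast; ring
  calc ∫⁻ k in cube d, ‖F k‖ₑ ^ p ≤ ∫⁻ k in cube d, ENNReal.ofReal (|C| ^ p * knorm k ^ (-q)) := lintegral_mono_ae hle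
    _ < ⊤ := by
        have := hΨ.2
        rw [HasFiniteIntegral] at this
        refine lt_of_le_of_lt (lintegral_mono fun k => ?_) this
        rw [← ofReal_norm, Real.norm_eq_abs]
        exact ENNReal.ofReal_le_ofReal (le_abs_self _)

/-- `G = τ_{p_c}(0,·)` itself is `L^p`-dominated for `2p < d` (the case `b = 0`: the infrared bound
`|Ĝ(k)| ≤ C/|k|²`). [cite: Hara2008, Lemma 4.1 (m = 0) and §4.1.2] -/
theorem IsLaceCoefficientPc.lpDominated_tau (h : IsLaceCoefficientPc d Φ) {M : ℕ} (hM2 : 2 ≤ M)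
    (hmom : Summable fun x => (1 + euclidNorm x) ^ M * |Φ x|) {p : ℝ} (hp : 1 ≤ p) (hpd : 2 * p < d) :
    LpDominated (fun y => tau d (criticalProbI d) 0 y) p := by
  obtain ⟨j⟩ : Nonempty (Fin d) := ⟨⟨0, by
    have : (2 : ℝ) * 1 ≤ 2 * p := by gcongr
    have : (0 : ℝ) < d := by linarith
    exact_mod_cast this⟩⟩
  have h0 := h.lpDominated_coordG_even hM2 hmom j (b := 0) (by omega) hp (by push_cast; linarith)
  refine h0.mono fun y => le_of_eq ?_
  simp [coordG]

/-- The integer engine from a real moment `Σ_x |x|^φ |Π(x)| < ∞`, `φ ≥ 2`: `G_j^{(2b)}` is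
`L^p`-dominated for `2b ≤ ⌊φ⌋`, `p ≥ 1`, `(2 + 2b)p < d`. [cite: Hara2008, Lemma 1.7 and §4.1.2] -/
theorem IsLaceCoefficientPc.lpDominated_coordG_even_of_rpow (h : IsLaceCoefficientPc d Φ) {φ : ℝ}
    (hφ2 : 2 ≤ φ) (hmom : Summable fun x => euclidNorm x ^ φ * |Φ x|) (j : Fin d) {b : ℕ}
    (hb : 2 * b ≤ ⌊φ⌋₊) {p : ℝ} (hp : 1 ≤ p) (hpd : (2 + 2 * b) * p < d) :
    LpDominated (coordG d (2 * (b : ℝ)) j) p := by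
  have hM : Summable fun x => (1 + euclidNorm x) ^ ⌊φ⌋₊ * |Φ x| :=
    summable_one_add_pow_mul_abs_of_rpow (Nat.floor_le (by linarith)) h.summable_abs hmom
  have h2 : 2 ≤ ⌊φ⌋₊ := Nat.le_floor (by exact_mod_cast hφ2)
  exact h.lpDominated_coordG_even h2 hM j hb hp hpd

/-- `G` is `L^p`-dominated for `2p < d`, from a real moment. [cite: Hara2008, Lemma 4.1 (m = 0)] -/
theorem IsLaceCoefficientPc.lpDominated_tau_of_rpow (h : IsLaceCoefficientPc d Φ) {φ : ℝ}
    (hφ2 : 2 ≤ φ) (hmom : Summable fun x => euclidNorm x ^ φ * |Φ x|) {p : ℝ} (hp : 1 ≤ p)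
    (hpd : 2 * p < d) : LpDominated (fun y => tau d (criticalProbI d) 0 y) p := by
  have hM : Summable fun x => (1 + euclidNorm x) ^ ⌊φ⌋₊ * |Φ x| :=
    summable_one_add_pow_mul_abs_of_rpow (Nat.floor_le (by linarith)) h.summable_abs hmom
  have h2 : 2 ≤ ⌊φ⌋₊ := Nat.le_floor (by exact_mod_cast hφ2)
  exact h.lpDominated_tau h2 hM hp hpd

end IntegerEngine

/-! ### Hölder weights realising Hara's power counting -/

namespace HaraNorms

/-- **Two Hölder weights**: for `A, B > 0` with `A + B < D` the weights `w₀ = A/(A+B)`,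
`w₁ = B/(A+B)` have `A/w₀ = B/w₁ = A + B < D` (power counting "`4 + β + γ < d`" with `A = 2 + β`,
`B = 2 + γ`). [cite: Hara2008, §4.1.2 ((4.13))] -/
theorem exists_weights₂ {A B D : ℝ} (hA : 0 < A) (hB : 0 < B) (h : A + B < D) :
    ∃ w₀ w₁ : ℝ, 0 < w₀ ∧ 0 < w₁ ∧ w₀ + w₁ = 1 ∧ 1 ≤ 1 / w₀ ∧ 1 ≤ 1 / w₁ ∧
      A * (1 / w₀) < D ∧ B * (1 / w₁) < D := by
  have hS : 0 < A + B := by positivity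
  refine ⟨A / (A + B), B / (A + B), div_pos hA hS, div_pos hB hS, ?_, ?_, ?_, ?_, ?_⟩
  · field_simp
  · rw [one_div_div, le_div_iff₀ hA]; linarith
  · rw [one_div_div, le_div_iff₀ hB]; linarith
  · rw [one_div_div, mul_div_cancel₀ _ hA.ne']; exact h
  · rw [one_div_div, mul_div_cancel₀ _ hB.ne']; exact h

/-- **Three Hölder weights** (`A + B + C < D`; "`T` is handled in exactly the same way").
[cite: Hara2008, §4.1.2] -/
theorem exists_weights₃ {A B C D : ℝ} (hA : 0 < A) (hB : 0 < B) (hC : 0 < C) (h : A + B + C < D) :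
    ∃ w₀ w₁ w₂ : ℝ, 0 < w₀ ∧ 0 < w₁ ∧ 0 < w₂ ∧ w₀ + w₁ + w₂ = 1 ∧ 1 ≤ 1 / w₀ ∧ 1 ≤ 1 / w₁ ∧ 1 ≤ 1 / w₂ ∧
      A * (1 / w₀) < D ∧ B * (1 / w₁) < D ∧ C * (1 / w₂) < D := by
  have hS : 0 < A + B + C := by positivity
  refine ⟨A / (A + B + C), B / (A + B + C), C / (A + B + C), div_pos hA hS, div_pos hB hS, div_pos hC hS,
    ?_, ?_, ?_, ?_, ?_, ?_, ?_⟩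
  · field_simp
  · rw [one_div_div, le_div_iff₀ hA]; linarith
  · rw [one_div_div, le_div_iff₀ hB]; linarith
  · rw [one_div_div, le_div_iff₀ hC]; linarith
  · rw [one_div_div, mul_div_cancel₀ _ hA.ne']; exact h
  · rw [one_div_div, mul_div_cancel₀ _ hB.ne']; exact h
  · rw [one_div_div, mul_div_cancel₀ _ hC.ne']; exact h

/-- **Four Hölder weights** (`A + B + C + E < D`; "the second integral is finite if
`2 + γ + 6 < d`"). [cite: Hara2008, §4.1.2 ((4.14))] -/
theorem exists_weights₄ {A B C E D : ℝ} (hA : 0 < A) (hB : 0 < B) (hC : 0 < C) (hE : 0 < E)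
    (h : A + B + C + E < D) :
    ∃ w₀ w₁ w₂ w₃ : ℝ, 0 < w₀ ∧ 0 < w₁ ∧ 0 < w₂ ∧ 0 < w₃ ∧ w₀ + w₁ + w₂ + w₃ = 1 ∧
      1 ≤ 1 / w₀ ∧ 1 ≤ 1 / w₁ ∧ 1 ≤ 1 / w₂ ∧ 1 ≤ 1 / w₃ ∧
      A * (1 / w₀) < D ∧ B * (1 / w₁) < D ∧ C * (1 / w₂) < D ∧ E * (1 / w₃) < D := by
  have hS : 0 < A + B + C + E := by positivity
  refine ⟨A / (A + B + C + E), B / (A + B + C + E), C / (A + B + C + E), E / (A + B + C + E),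
    div_pos hA hS, div_pos hB hS, div_pos hC hS, div_pos hE hS, ?_, ?_, ?_, ?_, ?_, ?_, ?_, ?_, ?_⟩
  · field_simp
  · rw [one_div_div, le_div_iff₀ hA]; linarith
  · rw [one_div_div, le_div_iff₀ hB]; linarith
  · rw [one_div_div, le_div_iff₀ hC]; linarith
  · rw [one_div_div, le_div_iff₀ hE]; linarith
  · rw [one_div_div, mul_div_cancel₀ _ hA.ne']; exact h
  · rw [one_div_div, mul_div_cancel₀ _ hB.ne']; exact h
  · rw [one_div_div, mul_div_cancel₀ _ hC.ne']; exact h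
  · rw [one_div_div, mul_div_cancel₀ _ hE.ne']; exact h

end HaraNorms

/-! ### Lemma 1.7 for even integer exponents -/

section EvenIntegers

variable {Φ : Site d → ℝ}

/-- **`W̄^{(2b,2b')} < ∞` for `2b, 2b' ≤ ⌊φ⌋` and `4 + 2b + 2b' < d`** (Lemma 1.7, `W̄`-clause,
even integer exponents). [cite: Hara2008, Lemma 1.7 ((1.31)) and §4.1.2 ((4.13))] -/
theorem IsLaceCoefficientPc.haraWBar_lt_top_even (h : IsLaceCoefficientPc d Φ) {φ : ℝ} (hφ2 : 2 ≤ φ)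
    (hmom : Summable fun x => euclidNorm x ^ φ * |Φ x|) {b b' : ℕ} (hb : 2 * b ≤ ⌊φ⌋₊)
    (hb' : 2 * b' ≤ ⌊φ⌋₊) (hbd : (4 + 2 * b + 2 * b' : ℝ) < d) :
    haraWBar d (2 * (b : ℝ)) (2 * (b' : ℝ)) < ⊤ := by
  obtain ⟨w₀, w₁, hw₀, hw₁, hw, h1₀, h1₁, hA, hB⟩ :=
    HaraNorms.exists_weights₂ (A := 2 + 2 * b) (B := 2 + 2 * b') (D := d) (by positivity) (by positivity)
      (by linarith)
  have hd : 1 ≤ d := by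
    have : (0 : ℝ) < d := by linarith [show (0 : ℝ) ≤ b from Nat.cast_nonneg b, show (0 : ℝ) ≤ b' from Nat.cast_nonneg b']
    exact_mod_cast this
  exact haraWBar_lt_top_of_lpDominated hd (by positivity) (by positivity) hw₀ hw₁ hw
    (fun j => h.lpDominated_coordG_even_of_rpow hφ2 hmom j hb h1₀ hA)
    (fun l => h.lpDominated_coordG_even_of_rpow hφ2 hmom l hb' h1₁ hB)

/-- **`T̄^{(2b,2b')} < ∞` for `2b, 2b' ≤ ⌊φ⌋` and `6 + 2b + 2b' < d`** (Lemma 1.7, `T̄`-clause, even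
integer exponents). [cite: Hara2008, Lemma 1.7 ((1.32)) and §4.1.2] -/
theorem IsLaceCoefficientPc.haraTBar_lt_top_even (h : IsLaceCoefficientPc d Φ) {φ : ℝ} (hφ2 : 2 ≤ φ)
    (hmom : Summable fun x => euclidNorm x ^ φ * |Φ x|) {b b' : ℕ} (hb : 2 * b ≤ ⌊φ⌋₊)
    (hb' : 2 * b' ≤ ⌊φ⌋₊) (hbd : (6 + 2 * b + 2 * b' : ℝ) < d) :
    haraTBar d (2 * (b : ℝ)) (2 * (b' : ℝ)) < ⊤ := by
  obtain ⟨w₀, w₁, w₂, hw₀, hw₁, hw₂, hw, h1₀, h1₁, h1₂, hA, hB, hC⟩ :=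
    HaraNorms.exists_weights₃ (A := 2 + 2 * b) (B := 2 + 2 * b') (C := 2) (D := d) (by positivity)
      (by positivity) two_pos (by linarith)
  have hd : 1 ≤ d := by
    have : (0 : ℝ) < d := by linarith [show (0 : ℝ) ≤ b from Nat.cast_nonneg b, show (0 : ℝ) ≤ b' from Nat.cast_nonneg b']
    exact_mod_cast this
  exact haraTBar_lt_top_of_lpDominated hd (by positivity) (by positivity) hw₀ hw₁ hw₂ hw
    (fun j => h.lpDominated_coordG_even_of_rpow hφ2 hmom j hb h1₀ hA)
    (fun l => h.lpDominated_coordG_even_of_rpow hφ2 hmom l hb' h1₁ hB)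
    (h.lpDominated_tau_of_rpow hφ2 hmom h1₂ hC)

/-- **`S̄^{(2b)} < ∞` for `2b ≤ ⌊φ⌋` and `8 + 2b < d`** (Lemma 1.7, `S̄`-clause, even integer
exponents). [cite: Hara2008, Lemma 1.7 ((1.33)) and §4.1.2 ((4.14))] -/
theorem IsLaceCoefficientPc.haraSBar_lt_top_even (h : IsLaceCoefficientPc d Φ) {φ : ℝ} (hφ2 : 2 ≤ φ)
    (hmom : Summable fun x => euclidNorm x ^ φ * |Φ x|) {b : ℕ} (hb : 2 * b ≤ ⌊φ⌋₊)
    (hbd : (8 + 2 * b : ℝ) < d) : haraSBar d (2 * (b : ℝ)) < ⊤ := by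
  obtain ⟨w₀, w₁, w₂, w₃, hw₀, hw₁, hw₂, hw₃, hw, h1₀, h1₁, h1₂, h1₃, hA, hB, hC, hE⟩ :=
    HaraNorms.exists_weights₄ (A := 2 + 2 * b) (B := 2) (C := 2) (E := 2) (D := d) (by positivity)
      two_pos two_pos two_pos (by linarith)
  have hd : 1 ≤ d := by
    have : (0 : ℝ) < d := by linarith [show (0 : ℝ) ≤ b from Nat.cast_nonneg b]
    exact_mod_cast this
  exact haraSBar_lt_top_of_lpDominated hd (by positivity) hw₀ hw₁ hw₂ hw₃ hw
    (fun j => h.lpDominated_coordG_even_of_rpow hφ2 hmom j hb h1₀ hA)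
    (h.lpDominated_tau_of_rpow hφ2 hmom h1₁ hB) (h.lpDominated_tau_of_rpow hφ2 hmom h1₂ hC)
    (h.lpDominated_tau_of_rpow hφ2 hmom h1₃ hE)

/-- **`H̄^{(2b)} < ∞` for `2b ≤ ⌊φ⌋`, `4 + 2b < d` and `d > 8`** (Lemma 1.7, `H̄`-clause, even integer
exponents; `d > 8` for `S̄^{(0)} < ∞` in the `x`-space bound `H̄ ≤ W̄ W̄ S̄`).
[cite: Hara2008, Lemma 1.7 ((1.34)) and §4.1.2 ((4.15))] -/
theorem IsLaceCoefficientPc.haraHBar_lt_top_even (h : IsLaceCoefficientPc d Φ) {φ : ℝ} (hφ2 : 2 ≤ φ)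
    (hmom : Summable fun x => euclidNorm x ^ φ * |Φ x|) {b : ℕ} (hb : 2 * b ≤ ⌊φ⌋₊)
    (hbd : (4 + 2 * b : ℝ) < d) (hd8 : 8 < d) : haraHBar d (2 * (b : ℝ)) < ⊤ := by
  have hW := h.haraWBar_lt_top_even hφ2 hmom hb (b' := 0) (by omega) (by push_cast; linarith)
  have hW0 := h.haraWBar_lt_top_even hφ2 hmom (b := 0) (b' := 0) (by omega) (by omega)
    (by push_cast; linarith [show (8 : ℝ) < d by exact_mod_cast hd8])
  have hS := h.haraSBar_lt_top_even hφ2 hmom (b := 0) (by omega)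
    (by push_cast; linarith [show (8 : ℝ) < d by exact_mod_cast hd8])
  push_cast at hW hW0 hS
  simp only [mul_zero] at hW hW0 hS
  exact haraHBar_lt_top_of_bars hW hW0 hS

end EvenIntegers


end Literature.Barriers.CriticalPhenomena
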